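import Literature.MathematicalPhysics.QuantumLattice.GibbsEnergyEntropyBalanceMatrixCuts
import HarnessLib

/-!
# KMS MOMENT (matrix) cuts for canonical Gibbs eigen-mixtures: every linear KMS constraint on
# single-generator spectral data, from a one-parameter semidefinite condition

Topic `Literature/MathematicalPhysics/QuantumLattice`; the common generalisation of
`GibbsEnergyEntropyBalance.lean` (scalar linearised Araki–Sewell rows) and
`GibbsEnergyEntropyBalanceMatrixCuts.lean` (matrix energy–entropy-balance cuts, iterated commutator of
order `≤ 1`). Written for the `T > 0` certificate family of the Hubbard programme.

For the Gibbs state `ω = tr(e^{−βH} ·)/Z` of a finite system and operators `a_i`, every expectation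
`ω(a_iᴴ ad_H^k(a_j))`, `ad_H(X) = HX − XH`, is the `k`-th moment of a (matrix-valued) spectral measure:
in the energy eigenbasis `H v_b = E_b v_b`,

  `Σ_c e^{−βE_c} ⟨v_c, a_iᴴ ad_H^k(a_j) v_c⟩ = Σ_{b,c} e^{−βE_c} (E_b − E_c)^k · conj⟨v_b, a_i v_c⟩ ⟨v_b, a_j v_c⟩`,
  `Σ_c e^{−βE_c} ⟨v_c, ad_H^k(a_j) a_iᴴ v_c⟩ = Σ_{b,c} e^{−βE_c} e^{−β(E_b−E_c)} (E_b − E_c)^k · (same)`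

— the second line is DETAILED BALANCE (the KMS condition read on spectral measures:
`dμ_{aᴴ}(−ω) = e^{−βω} dμ_a(ω)`). Consequently, for coefficient matrices `P_0 … P_K`, `Q_0 … Q_K`
(`m × m`, complex) the row

  `R = Σ_k β^k Σ_{ij} [ (P_k)_{ij} · a_iᴴ ad_H^k(a_j) + (Q_k)_{ij} · ad_H^k(a_j) a_iᴴ ]`

has Gibbs value `Σ_{b,c} e^{−βE_c} · u_{bc}⋆ Π(β(E_b − E_c)) u_{bc}`, `(u_{bc})_j = ⟨v_b, a_j v_c⟩`, with the
matrix EXPONENTIAL POLYNOMIAL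

  `Π(u) = Σ_k u^k P_k + e^{−u} Σ_k u^k Q_k`,

so `R` is nonnegative in the Gibbs state as soon as `Π(u) ⪰ 0` for every real `u` (a β-FREE,
ONE-PARAMETER SEMIDEFINITE CONDITION). This is the complete family of LINEAR constraints that the β-KMS
condition imposes on the truncated two-sided moment data of the generators (the dual cone of the
exponential-polynomial moment cone); `K = 1`, `P_0 = Λ_A`, `Q_0 = Λ_B`, `P_1 = Λ_C`, `Q_1 = 0` are the
matrix energy–entropy-balance cuts, and `m = 1` gives the scalar «KMS moment rows»
`Σ_k p_k ω(aᴴ ad_H^k a) + Σ_k q_k ω(ad_H^k(a) aᴴ) ≥ 0` for `p(u) + q(u)e^{−u} ≥ 0` on `ℝ`, among them the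
tangent rows (`p = u − s`, `q = e^{s−1}`) and the correlation inequalities of Bogoliubov–Harris,
Brankov–Tonchev, Roepstorff and Itoi–Ishimori–Sato–Sakamoto type that are linear in word expectations
(e.g. Itoi et al. Thm. 3, `n = 0`: `⟨[A†,[H,A]]⟩ ≤ (β/2)⟨{[H,A]†,[H,A]}⟩`, the member
`Π(u) = ½u²(1 + e^{−u}) − u(1 − e^{−u}) ≥ 0`).

* §1 eigenbasis bookkeeping for iterated commutators: `iterate_commutator_diagonal_apply`
  (`(ad_D^k C)_{bc} = (d_b − d_c)^k C_{bc}` for `D = diagonal d`) and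
  `conjTranspose_mul_iterate_commutator_mul` (`Vᴴ ad_H^k(X) V = ad_D^k(Vᴴ X V)` when `Vᴴ H V = D`,
  `V Vᴴ = 1`).
* §2 `sum_exp_mul_re_expect_momentCut_nonneg` — full space, Boltzmann weights (any Hermitian `H`, any
  generators, any real `β`, any `K`).
* Companion `GibbsKMSMomentCutsSector.lean`: §3 the scalar rows (`m = 1`, hypothesis
  `0 ≤ Σ_k p_k u^k + e^{−u} Σ_k q_k u^k` for all real `u`) and the `K = 1` comparison with
  `GibbsEnergyEntropyBalanceMatrixCuts`; §4 the canonical SECTOR eigen-mixture (`canonicalWeight`,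
  `sectorEigenvector` of `TorusSectorGibbsMixture.lean`) for generators `a_i` such that `a_i` and `a_iᴴ`
  preserve the sector (gauge-invariant generators of a canonical state; the canonical state is not KMS for
  sector-changing generators).

Everything is PROVED; no definition, no named fact. A positivity CERTIFICATE format for scalar
exponential polynomials on all of `ℝ` and the torus / torus-limit packaging follow in companion files.

## Mathlib / tree search

REUSED: Mathlib `Matrix.PosSemidef.dotProduct_mulVec_nonneg`, `Matrix.IsHermitian.eigenvectorUnitary(_apply)`,
`.mulVec_eigenvectorBasis`, `Function.iterate_succ_apply'`, `Matrix.diagonal_mul`, `Matrix.mul_diagonal`;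
the proof follows `sum_exp_mul_re_expect_matrixCut_nonneg` (`GibbsEnergyEntropyBalanceMatrixCuts`) slice by
slice in `k`.
`lean search 'iterate.*H \* X - X \* H|KMS moment|detailed balance|Brankov|Roepstorff'`: no iterated-commutator
rows for Gibbs states in the tree (2026-08-27); the Bogoliubov inequality (Duhamel two-point function, not a
word expectation) is `BogoliubovInequalityGeneral.lean` / `GibbsBogoliubovRow.lean` and is not of this form.

## References

* C. Itoi, H. Ishimori, K. Sato, Y. Sakamoto, *Extended series of correlation inequalities in quantum
  systems*, J. Phys. Soc. Jpn. 92 (2023) 074001 = arXiv:2306.03489, §2 Thms. 1–4, §3 Lemmas 1–6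
  (spectral representation `Q_{A†,A}(ω)`, detailed balance factor `1 + e^{−βω}`,
  `ω^{2k} Q_{A†,A} = Q_{C_A^{k}†, C_A^k}`, sign-definite Taylor remainders). [cite: ItoiEtAl2023, Lemma 5]
* H. Fawzi, O. Fawzi, S. O. Scalet, Nat. Commun. 15 (2024) 7394 = arXiv:2311.18706, §3.1 Thm. 3.1, §3.2
  Thm. 3.4 (EEB ⟺ KMS; matrix EEB). [cite: FawziFawziScalet2024, Thm. 3.4]
* O. Bratteli, D. W. Robinson, *OAQSM 2* (1997), Thm. 5.3.15 (auto-correlation bounds ⟺ KMS) and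
  Prop. 5.3.14 (the KMS condition on spectral measures). [cite: BratteliRobinsonII1997, Thm. 5.3.15]
-/

noncomputable section

namespace Literature.MathematicalPhysics.QuantumLattice

open Matrix Finset
open scoped ComplexOrder BigOperators

/-! ### §1 Iterated commutators in the eigenbasis -/

section Eigenbasis

variable {κ : Type*} [Fintype κ] [DecidableEq κ]

/-- **Iterated commutators with a diagonal matrix act entrywise**: for `D = diagonal d`,
`(ad_D^k C)_{bc} = (d_b − d_c)^k · C_{bc}` — in the energy eigenbasis the `k`-fold commutator with the
Hamiltonian multiplies the `(b, c)` matrix element by the `k`-th power of the Bohr frequency `E_b − E_c`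
(Itoi et al., proof of Lemma 5: `ω^{2k} Q_{A†,A}(ω) = Q_{C_A^k†,C_A^k}(ω)`). [cite: ItoiEtAl2023, Lemma 5] -/
theorem iterate_commutator_diagonal_apply (d : κ → ℂ) (C : Matrix κ κ ℂ) (k : ℕ) (b c : κ) :
    ((fun X : Matrix κ κ ℂ => diagonal d * X - X * diagonal d)^[k] C) b c = (d b - d c) ^ k * C b c := by
  induction k with
  | zero => simp
  | succ k ih =>
    rw [Function.iterate_succ_apply', Matrix.sub_apply, diagonal_mul, mul_diagonal, ih, pow_succ]
    ring

/-- **Change of basis intertwines the iterated commutators**: if `V Vᴴ = 1` and `Vᴴ H V = D` then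
`Vᴴ ad_H^k(X) V = ad_D^k(Vᴴ X V)` for every `X` and `k`. [cite: ItoiEtAl2023, Lemma 5] -/
theorem conjTranspose_mul_iterate_commutator_mul {V H D : Matrix κ κ ℂ} (hVV' : V * Vᴴ = 1)
    (hD : Vᴴ * H * V = D) (X : Matrix κ κ ℂ) (k : ℕ) :
    Vᴴ * ((fun Y : Matrix κ κ ℂ => H * Y - Y * H)^[k] X) * V =
      (fun Y : Matrix κ κ ℂ => D * Y - Y * D)^[k] (Vᴴ * X * V) := by
  have hconj : ∀ Y Z : Matrix κ κ ℂ, Vᴴ * (Y * Z) * V = (Vᴴ * Y * V) * (Vᴴ * Z * V) := by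
    intro Y Z
    calc Vᴴ * (Y * Z) * V = Vᴴ * (Y * (V * Vᴴ) * Z) * V := by rw [hVV', Matrix.mul_one]
      _ = (Vᴴ * Y * V) * (Vᴴ * Z * V) := by simp only [Matrix.mul_assoc]
  induction k with
  | zero => rfl
  | succ k ih =>
    rw [Function.iterate_succ_apply', Function.iterate_succ_apply', ← ih, Matrix.mul_sub, Matrix.sub_mul,
      hconj, hconj, hD]

end Eigenbasis

/-! ### §2 KMS moment cuts for the canonical eigen-mixture of a Hermitian matrix (full space) -/

section FullSpace

variable {κ : Type*} [Fintype κ] [DecidableEq κ]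
variable {m : Type*} [Fintype m]

omit [DecidableEq κ] in
/-- A diagonal entry of `Vᴴ X V`. [folklore] -/
private theorem conjTranspose_mul_mul_apply_same₄ (V X : Matrix κ κ ℂ) (c : κ) :
    (Vᴴ * X * V) c c = star (fun i => V i c) ⬝ᵥ (X *ᵥ fun i => V i c) := by
  rw [Matrix.mul_assoc, Matrix.mul_apply]
  simp only [conjTranspose_apply, dotProduct, Pi.star_apply, mulVec, Matrix.mul_apply]

omit [Fintype κ] [DecidableEq κ] in
/-- Quadratic forms written out: `Σ_{ij} M_{ij} ū_i u_j = u⋆ (M u)`. [folklore] -/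
private theorem sum_sum_mul_star_mul_eq_dotProduct_mulVec (M : Matrix m m ℂ) (u : m → ℂ) :
    ∑ i, ∑ j, M i j * (star (u i) * u j) = star u ⬝ᵥ (M *ᵥ u) := by
  simp only [dotProduct, mulVec, Pi.star_apply, Finset.mul_sum]
  refine Finset.sum_congr rfl fun i _ => Finset.sum_congr rfl fun j _ => ?_
  ring

/-- **KMS moment cuts for the canonical eigen-mixture of a Hermitian matrix (Boltzmann weights,
unnormalised).** Let `H` be Hermitian with Mathlib eigenbasis `v_c` and eigenvalues `E_c`,
`a : m → Matrix` a finite family of generators, `β` real, `K : ℕ`, and `P, Q : Fin (K+1) → Matrix m m ℂ`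
coefficient matrices such that the matrix exponential polynomial
`Π(u) = Σ_k u^k P_k + e^{−u} Σ_k u^k Q_k` is positive semidefinite for every real `u`. Then the KMS MOMENT CUT
`R = Σ_k Σ_{ij} [ β^k (P_k)_{ij} · a_iᴴ ad_H^k(a_j) + β^k (Q_k)_{ij} · ad_H^k(a_j) a_iᴴ ]`,
`ad_H(X) = HX − XH`, is nonnegative in the Gibbs mixture: `0 ≤ Σ_c e^{−βE_c} Re⟨v_c, R v_c⟩`. In the
eigenbasis the sum is `Σ_{b,c} e^{−βE_c} · u_{bc}⋆ Π(β(E_b − E_c)) u_{bc}`, `(u_{bc})_j = ⟨v_b, a_j v_c⟩`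
(moments of the spectral measure and detailed balance `e^{−βE_b} = e^{−βE_c} e^{−β(E_b − E_c)}`), termwise
`≥ 0`. `K = 1` is the matrix energy–entropy-balance cut; `m = 1` are the scalar KMS moment rows (the linear
correlation inequalities of Itoi–Ishimori–Sato–Sakamoto type). [cite: ItoiEtAl2023, Lemma 5]
[cite: FawziFawziScalet2024, Thm. 3.4] -/
theorem sum_exp_mul_re_expect_momentCut_nonneg {H : Matrix κ κ ℂ} (hH : H.IsHermitian)
    (a : m → Matrix κ κ ℂ) (β : ℝ) {K : ℕ} {P Q : Fin (K + 1) → Matrix m m ℂ}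
    (hPi : ∀ u : ℝ, (∑ k : Fin (K + 1), ((u ^ (k : ℕ) : ℝ) : ℂ) • P k +
        ((Real.exp (-u) : ℝ) : ℂ) • ∑ k : Fin (K + 1), ((u ^ (k : ℕ) : ℝ) : ℂ) • Q k).PosSemidef) :
    0 ≤ ∑ c, Real.exp (-(β * hH.eigenvalues c)) *
      (star (fun i => (hH.eigenvectorUnitary : Matrix κ κ ℂ) i c) ⬝ᵥ
        ((∑ k : Fin (K + 1), ∑ i, ∑ j,
            ((((β ^ (k : ℕ) : ℝ) : ℂ) * P k i j) •
                ((a i)ᴴ * (fun X : Matrix κ κ ℂ => H * X - X * H)^[(k : ℕ)] (a j)) +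
              (((β ^ (k : ℕ) : ℝ) : ℂ) * Q k i j) •
                ((fun X : Matrix κ κ ℂ => H * X - X * H)^[(k : ℕ)] (a j) * (a i)ᴴ))) *ᵥ
          fun i => (hH.eigenvectorUnitary : Matrix κ κ ℂ) i c)).re := by
  set V : Matrix κ κ ℂ := (hH.eigenvectorUnitary : Matrix κ κ ℂ) with hV
  set E : κ → ℝ := hH.eigenvalues with hE
  -- the `k`-slices of the cut
  set Rk : Fin (K + 1) → Matrix κ κ ℂ := fun k => ∑ i, ∑ j,
      ((((β ^ (k : ℕ) : ℝ) : ℂ) * P k i j) •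
          ((a i)ᴴ * (fun X : Matrix κ κ ℂ => H * X - X * H)^[(k : ℕ)] (a j)) +
        (((β ^ (k : ℕ) : ℝ) : ℂ) * Q k i j) •
          ((fun X : Matrix κ κ ℂ => H * X - X * H)^[(k : ℕ)] (a j) * (a i)ᴴ)) with hRk
  -- unitarity and `H V = V D`
  have hVV : Vᴴ * V = 1 := by
    have h := Matrix.mem_unitaryGroup_iff'.1 hH.eigenvectorUnitary.2
    rwa [Matrix.star_eq_conjTranspose] at h
  have hVV' : V * Vᴴ = 1 := by
    have h := Matrix.mem_unitaryGroup_iff.1 hH.eigenvectorUnitary.2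
    rwa [Matrix.star_eq_conjTranspose] at h
  set D : Matrix κ κ ℂ := diagonal (fun b => ((E b : ℝ) : ℂ)) with hD
  have hHV : H * V = V * D := by
    ext i c
    have hcol : (fun b => V b c) = ⇑(hH.eigenvectorBasis c) := funext fun b => by
      rw [hV, Matrix.IsHermitian.eigenvectorUnitary_apply]
    have h := hH.mulVec_eigenvectorBasis c
    rw [← hcol] at h
    have hi := congrFun h i
    simp only [mulVec, dotProduct, Pi.smul_apply] at hi
    rw [hD, mul_diagonal, Matrix.mul_apply, hi, RCLike.real_smul_eq_coe_mul, mul_comm]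
    rfl
  have hD' : Vᴴ * H * V = D := by
    rw [Matrix.mul_assoc, hHV, ← Matrix.mul_assoc, hVV, Matrix.one_mul]
  -- the generators in the eigenbasis
  set C : m → Matrix κ κ ℂ := fun i => Vᴴ * a i * V with hC
  have hCt : ∀ i, (C i)ᴴ = Vᴴ * (a i)ᴴ * V := fun i => by
    rw [hC]
    dsimp only
    rw [conjTranspose_mul, conjTranspose_mul, conjTranspose_conjTranspose, Matrix.mul_assoc]
  have hconj : ∀ Y Z : Matrix κ κ ℂ, Vᴴ * (Y * Z) * V = (Vᴴ * Y * V) * (Vᴴ * Z * V) := by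
    intro Y Z
    calc Vᴴ * (Y * Z) * V = Vᴴ * (Y * (V * Vᴴ) * Z) * V := by rw [hVV', Matrix.mul_one]
      _ = (Vᴴ * Y * V) * (Vᴴ * Z * V) := by simp only [Matrix.mul_assoc]
  -- iterated commutators in the eigenbasis
  have had : ∀ (j : m) (k : ℕ), Vᴴ * ((fun X : Matrix κ κ ℂ => H * X - X * H)^[k] (a j)) * V =
      (fun Y : Matrix κ κ ℂ => D * Y - Y * D)^[k] (C j) := fun j k =>
    conjTranspose_mul_iterate_commutator_mul hVV' hD' (a j) k
  have hadD : ∀ (j : m) (k : ℕ) (b c : κ), ((fun Y : Matrix κ κ ℂ => D * Y - Y * D)^[k] (C j)) b c =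
      (((E b - E c) ^ k : ℝ) : ℂ) * C j b c := by
    intro j k b c
    rw [hD, iterate_commutator_diagonal_apply, ← Complex.ofReal_sub, ← Complex.ofReal_pow]
  -- Boltzmann weights
  set w : κ → ℂ := fun c => ((Real.exp (-(β * E c)) : ℝ) : ℂ) with hw
  have hwb : ∀ b c, w b = w c * ((Real.exp (-(β * (E b - E c))) : ℝ) : ℂ) := by
    intro b c
    simp only [hw]
    rw [← Complex.ofReal_mul, ← Real.exp_add]
    ring_nf
  -- the two spectral sums (moments; moments with detailed balance)
  have tP : ∀ (i j : m) (k : ℕ),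
      ∑ c, w c * (Vᴴ * ((a i)ᴴ * (fun X : Matrix κ κ ℂ => H * X - X * H)^[k] (a j)) * V) c c =
        ∑ c, ∑ b, w c * ((((E b - E c) ^ k : ℝ) : ℂ) * (star (C i b c) * C j b c)) := by
    intro i j k
    refine Finset.sum_congr rfl fun c _ => ?_
    rw [hconj, ← hCt, had, Matrix.mul_apply, Finset.mul_sum]
    refine Finset.sum_congr rfl fun b _ => ?_
    rw [conjTranspose_apply, hadD]
    ring
  have tQ : ∀ (i j : m) (k : ℕ),
      ∑ c, w c * (Vᴴ * ((fun X : Matrix κ κ ℂ => H * X - X * H)^[k] (a j) * (a i)ᴴ) * V) c c =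
        ∑ c, ∑ b, w b * ((((E b - E c) ^ k : ℝ) : ℂ) * (star (C i b c) * C j b c)) := by
    intro i j k
    have h1 : ∀ c, (Vᴴ * ((fun X : Matrix κ κ ℂ => H * X - X * H)^[k] (a j) * (a i)ᴴ) * V) c c =
        ∑ b, (((E c - E b) ^ k : ℝ) : ℂ) * C j c b * star (C i c b) := by
      intro c
      rw [hconj, ← hCt, had, Matrix.mul_apply]
      refine Finset.sum_congr rfl fun b _ => ?_
      rw [conjTranspose_apply, hadD]
    simp_rw [h1, Finset.mul_sum]
    rw [Finset.sum_comm]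
    refine Finset.sum_congr rfl fun c _ => Finset.sum_congr rfl fun b _ => ?_
    ring
  -- `⟨v_c, R_k v_c⟩` entrywise
  have hRcc : ∀ k c, star (fun i => V i c) ⬝ᵥ (Rk k *ᵥ fun i => V i c) =
      ∑ i, ∑ j, ((((β ^ (k : ℕ) : ℝ) : ℂ) * P k i j) *
          (Vᴴ * ((a i)ᴴ * (fun X : Matrix κ κ ℂ => H * X - X * H)^[(k : ℕ)] (a j)) * V) c c +
        (((β ^ (k : ℕ) : ℝ) : ℂ) * Q k i j) *
          (Vᴴ * ((fun X : Matrix κ κ ℂ => H * X - X * H)^[(k : ℕ)] (a j) * (a i)ᴴ) * V) c c) := by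
    intro k c
    rw [← conjTranspose_mul_mul_apply_same₄, hRk]
    dsimp only
    rw [Matrix.mul_sum, Matrix.sum_mul, Matrix.sum_apply]
    refine Finset.sum_congr rfl fun i _ => ?_
    rw [Matrix.mul_sum, Matrix.sum_mul, Matrix.sum_apply]
    refine Finset.sum_congr rfl fun j _ => ?_
    simp only [Matrix.mul_add, Matrix.add_mul, Matrix.mul_smul, Matrix.smul_mul, Matrix.add_apply,
      Matrix.smul_apply, smul_eq_mul]
  -- the slice identity: `Σ_c w_c ⟨v_c, R_k v_c⟩ = Σ_c Σ_b w_c · u_{bc}⋆ Π_k(β(E_b − E_c)) u_{bc}`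
  have hslice : ∀ k, ∑ c, w c * (star (fun i => V i c) ⬝ᵥ (Rk k *ᵥ fun i => V i c)) =
      ∑ c, ∑ b, w c * (star (fun j => C j b c) ⬝ᵥ
        (((((β * (E b - E c)) ^ (k : ℕ) : ℝ) : ℂ) • P k +
            ((Real.exp (-(β * (E b - E c))) * (β * (E b - E c)) ^ (k : ℕ) : ℝ) : ℂ) • Q k) *ᵥ
          fun j => C j b c)) := by
    intro k
    -- pull the `c`-sum inside
    have h1 : ∑ c, w c * (star (fun i => V i c) ⬝ᵥ (Rk k *ᵥ fun i => V i c)) =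
        ∑ i, ∑ j, ((((β ^ (k : ℕ) : ℝ) : ℂ) * P k i j) *
            ∑ c, w c * (Vᴴ * ((a i)ᴴ * (fun X : Matrix κ κ ℂ => H * X - X * H)^[(k : ℕ)] (a j)) * V) c c +
          (((β ^ (k : ℕ) : ℝ) : ℂ) * Q k i j) *
            ∑ c, w c * (Vᴴ * ((fun X : Matrix κ κ ℂ => H * X - X * H)^[(k : ℕ)] (a j) * (a i)ᴴ) * V) c c) := by
      simp_rw [hRcc, Finset.mul_sum]
      rw [Finset.sum_comm]
      refine Finset.sum_congr rfl fun i _ => ?_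
      rw [Finset.sum_comm]
      refine Finset.sum_congr rfl fun j _ => ?_
      rw [← Finset.sum_add_distrib]
      exact Finset.sum_congr rfl fun c _ => by ring
    -- insert the spectral sums and collect per `(b, c)`
    have h2 : ∀ i j, (((β ^ (k : ℕ) : ℝ) : ℂ) * P k i j) *
            ∑ c, w c * (Vᴴ * ((a i)ᴴ * (fun X : Matrix κ κ ℂ => H * X - X * H)^[(k : ℕ)] (a j)) * V) c c +
          (((β ^ (k : ℕ) : ℝ) : ℂ) * Q k i j) *
            ∑ c, w c * (Vᴴ * ((fun X : Matrix κ κ ℂ => H * X - X * H)^[(k : ℕ)] (a j) * (a i)ᴴ) * V) c c =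
        ∑ c, ∑ b, w c * (((((β * (E b - E c)) ^ (k : ℕ) : ℝ) : ℂ) • P k +
            ((Real.exp (-(β * (E b - E c))) * (β * (E b - E c)) ^ (k : ℕ) : ℝ) : ℂ) • Q k) i j *
          (star (C i b c) * C j b c)) := by
      intro i j
      rw [tP, tQ, Finset.mul_sum, Finset.mul_sum, ← Finset.sum_add_distrib]
      refine Finset.sum_congr rfl fun c _ => ?_
      rw [Finset.mul_sum, Finset.mul_sum, ← Finset.sum_add_distrib]
      refine Finset.sum_congr rfl fun b _ => ?_
      rw [hwb b c]
      simp only [Matrix.add_apply, Matrix.smul_apply, smul_eq_mul, mul_pow]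
      push_cast
      ring
    have hcomm4 : ∀ F : m → m → κ → κ → ℂ,
        ∑ i, ∑ j, ∑ c, ∑ b, F i j c b = ∑ c, ∑ b, ∑ i, ∑ j, F i j c b := by
      intro F
      calc ∑ i, ∑ j, ∑ c, ∑ b, F i j c b
          = ∑ i, ∑ c, ∑ j, ∑ b, F i j c b := Finset.sum_congr rfl fun i _ => Finset.sum_comm
        _ = ∑ c, ∑ i, ∑ j, ∑ b, F i j c b := Finset.sum_comm
        _ = ∑ c, ∑ i, ∑ b, ∑ j, F i j c b :=
            Finset.sum_congr rfl fun c _ => Finset.sum_congr rfl fun i _ => Finset.sum_comm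
        _ = ∑ c, ∑ b, ∑ i, ∑ j, F i j c b := Finset.sum_congr rfl fun c _ => Finset.sum_comm
    rw [h1]
    simp_rw [h2]
    refine (hcomm4 _).trans (Finset.sum_congr rfl fun c _ => Finset.sum_congr rfl fun b _ => ?_)
    rw [← sum_sum_mul_star_mul_eq_dotProduct_mulVec, Finset.mul_sum]
    refine Finset.sum_congr rfl fun i _ => ?_
    rw [Finset.mul_sum]
  -- assemble the slices: `⟨v_c, R v_c⟩ = Σ_k ⟨v_c, R_k v_c⟩`
  have hR : (∑ k : Fin (K + 1), ∑ i, ∑ j,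
      ((((β ^ (k : ℕ) : ℝ) : ℂ) * P k i j) •
          ((a i)ᴴ * (fun X : Matrix κ κ ℂ => H * X - X * H)^[(k : ℕ)] (a j)) +
        (((β ^ (k : ℕ) : ℝ) : ℂ) * Q k i j) •
          ((fun X : Matrix κ κ ℂ => H * X - X * H)^[(k : ℕ)] (a j) * (a i)ᴴ))) = ∑ k : Fin (K + 1), Rk k := by
    rw [hRk]
  have hRcc' : ∀ c, star (fun i => V i c) ⬝ᵥ ((∑ k : Fin (K + 1), Rk k) *ᵥ fun i => V i c) =
      ∑ k : Fin (K + 1), star (fun i => V i c) ⬝ᵥ (Rk k *ᵥ fun i => V i c) := by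
    intro c
    rw [← conjTranspose_mul_mul_apply_same₄, Matrix.mul_sum, Matrix.sum_mul, Matrix.sum_apply]
    exact Finset.sum_congr rfl fun k _ => conjTranspose_mul_mul_apply_same₄ V (Rk k) c
  -- the total: `Σ_c w_c ⟨v_c, R v_c⟩ = Σ_c Σ_b w_c · u_{bc}⋆ Π(β(E_b − E_c)) u_{bc}`
  have hsum : ∑ c, w c * (star (fun i => V i c) ⬝ᵥ ((∑ k : Fin (K + 1), Rk k) *ᵥ fun i => V i c)) =
      ∑ c, ∑ b, w c * (star (fun j => C j b c) ⬝ᵥ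
        ((∑ k : Fin (K + 1), (((β * (E b - E c)) ^ (k : ℕ) : ℝ) : ℂ) • P k +
            ((Real.exp (-(β * (E b - E c))) : ℝ) : ℂ) •
              ∑ k : Fin (K + 1), (((β * (E b - E c)) ^ (k : ℕ) : ℝ) : ℂ) • Q k) *ᵥ fun j => C j b c)) := by
    simp_rw [hRcc', Finset.mul_sum]
    rw [Finset.sum_comm]
    simp_rw [hslice]
    rw [Finset.sum_comm]
    refine Finset.sum_congr rfl fun c _ => ?_
    rw [Finset.sum_comm]
    refine Finset.sum_congr rfl fun b _ => ?_
    rw [← Finset.mul_sum]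
    congr 1
    simp_rw [← sum_sum_mul_star_mul_eq_dotProduct_mulVec]
    rw [Finset.sum_comm]
    refine Finset.sum_congr rfl fun i _ => ?_
    rw [Finset.sum_comm]
    refine Finset.sum_congr rfl fun j _ => ?_
    rw [← Finset.sum_mul]
    congr 1
    rw [Matrix.add_apply, Matrix.smul_apply, Matrix.sum_apply, Matrix.sum_apply, smul_eq_mul,
      Finset.mul_sum, ← Finset.sum_add_distrib]
    refine Finset.sum_congr rfl fun k _ => ?_
    simp only [Matrix.add_apply, Matrix.smul_apply, smul_eq_mul]
    push_cast
    ring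
  -- real parts
  have hre : ∑ c, Real.exp (-(β * E c)) * (star (fun i => V i c) ⬝ᵥ ((∑ k : Fin (K + 1), Rk k) *ᵥ fun i => V i c)).re =
      (∑ c, w c * (star (fun i => V i c) ⬝ᵥ ((∑ k : Fin (K + 1), Rk k) *ᵥ fun i => V i c))).re := by
    rw [Complex.re_sum]
    exact Finset.sum_congr rfl fun c _ => by rw [hw, Complex.re_ofReal_mul]
  rw [hR, hre, hsum, Complex.re_sum]
  refine Finset.sum_nonneg fun c _ => ?_
  rw [Complex.re_sum]
  refine Finset.sum_nonneg fun b _ => ?_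
  rw [hw, Complex.re_ofReal_mul]
  refine mul_nonneg (Real.exp_pos _).le ?_
  obtain ⟨hq, -⟩ := Complex.nonneg_iff.1 ((hPi (β * (E b - E c))).dotProduct_mulVec_nonneg (fun j => C j b c))
  exact hq

end FullSpace

end Literature.MathematicalPhysics.QuantumLattice

end
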